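import Summits.QuantumFields.YangMills.Theorems.UnitScaleTiltProp7KinvPiOfCone
import Summits.QuantumFields.YangMills.Theorems.UnitScaleTiltProp7Kernel133OfPiBlockLetters
import Summits.QuantumFields.YangMills.Theorems.UnitScaleTiltProp7GreenPiMinusEtaBlockDecay
import Summits.QuantumFields.YangMills.Theorems.UnitScaleTiltProp7Kernel137DoorOfKinvEntry
import HarnessLib

/-!
# Route `UnitScaleTilt`, crux K1 «MinimiserStabilityRegPr» (stmt-QuantumFields-19200), EX face — K-STOREY × N6, FILE (K5-cone, part C = THE Π-SLOT KNIT):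
# **`hKinv`(Π) AND THE EX ROW `h133` FOR ALL MEMBERS FROM THE `hKinv`(η) FAMILY AND THE FIVE BLOCK-LETTER FAMILIES OF `G₀`** — N6 FILE D4's `hΔb` in its Idx edition, the cone
# (part B ✓`kinvRow_pi_family_of_cone`), the rate toolkit and the H-KNIT (✓`kernel133_family_of_kinvRow_of_greenBlockSup` ∘ ✓`hGblk_pi_family_of_blockLetters`), ONE `obtain`-free chain

Cell `ym3-torus` (HUMAN RULING D-0037; rung R3 = SU(2) YM₃ on T³ — NOT d = 4, NOT infinite volume, NOT a mass gap, NOT Clay).  Width seat `ym3-torus-px10` (gen 14; FREE px; ★p1 g27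
CHAIR WORDS №34∕№35: the cone route; «h133(Π) ⟸ ✓p769611 ∘ {hKinv(Π) ⟸ PART A ∘ PART B ∘ {K2-storey, D4, Q-rows}, hGblk(Π) ⟸ D3} ∘ {(Gb), (Db), (c·b)} — every leaf named»).
THEOREMS ONLY (0 `def`, 0 `sorry`, default heartbeats); `--supports stmt-QuantumFields-19200 --as helper`; count-neutral.

THE INPUT FAMILIES (all under `RegPr ρ U₀ → ρ ≤ α L → Λ L i U₀ →`, cap `α` with the two windows of record, L-only weights `c₀ cB`, member couplings `0 ≤ a L i`, ANY thread `Λ`):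
`hposη`∕`hpos` — the classes `PosOnto` at `Δ^η` and at `Δ_πᴾ` ((γ) ✓`hco_DeltaEtaSlot_exists` ∕ ✓`hco_DeltaPiSlotP_exists`); `hKinv` — the coarse entry row of `K₀⁻¹ = (Q_kG₀Q_k†)⁻¹` at the
scaling of record `CK L·((c₀ L∕cB L)·ℓ³)`, rate `μ L > 0` (✓`Prop7KinvRowOfConjLetters.kinvRow_family_of_coercive_of_conjResolvent` at `Δx := DeltaEtaSlot`: m₀ ✓p770754 ⟸ px13 (K1b-a),
B_G∕hpos ⟸ (γ), δ₃ ⟸ px12 ✓p769533∕✓p770882∕✓p772864, window (R_L)); the FIVE BLOCK-SUPPORTED LETTERS of the scalar∕one-form storeys at an L-only rate `δ₁ L` with L-only constants —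
(Gb) `BV` (px16 ✓p768545 §3 ∕ ✓p771749 ∕ ✓p772637 `blockSup_GT_DeltaEtaSlot_family`), (Db) `BD` (px21 ✓p770568 ∕ ✓p771744 ∕ ✓p772615 `divergence_GT_DeltaEtaSlot_family`), (c1b)(c2b)(c3b)
`C₁ C₂ C₃` (px5 W4∕W5); an output rate `δ L` with `0 < ν L`, `δ L + ν L ≤ δ₁ L`, `2μ L ≤ δ L`; and TWO L-ONLY WINDOWS — D3∕D4's bootstrap window `hwin` (at `α L`, rate `δ L`, the `×(2(1+1∕ν L))³`
constants) and the cone's Neumann window `hcone` (`CK L·9600e^{2μ L+1}·κ L·(2(1+1∕μ L))³·3(2(1+2∕μ L))³·3(2(1+4∕μ L))³ < 1` for any L-only `κ L ≥ α L·κ′_V(L)`, `κ′_V` = D4's block-edition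
constant; NO `ℓ`, NO `c₀∕cB`).
WHAT IS PROVED (ns `Summit.QuantumFields.YangMills.Theorems.Prop7PiSlotRowsOfCone`).
* ★★ `hDelta_pi_family_of_blockLetters` — the Idx edition of D4 ✓`hDelta_pi_of_blockLetters`: the cone's `hΔb` FAMILY (part B's binder) with `κ L := α L·κ′_V(L)` at rate `δ L`.
* ★★★ `kinvRow_pi_family_of_blockLetters` — `hKinv`(Π) FOR ALL MEMBERS: the doors' `hKinv` family binder at `Δx := DeltaPiSlotP … (a L i)` with
  `CK L := (1∕(1 − hcone's LHS))·CK L·3(2(1+8∕μ L))³` at the scaling of record, rate `μ L∕8` (part B ∘ the above, `κ` enlarged by monotonicity).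
* ★★★ `kernel133_family_of_kinvRowEta_of_piBlockLetters` — THE S47 ROW TEXT OF `h133` FOR ALL MEMBERS from the same inputs: H-door ✓p769611 §4 fed the above and the H-KNIT's
  `hGblk_pi_family_of_blockLetters` (rate lowered `δ L → μ L∕8` by ✓`blockLetter_mono_rate`): `CH L := 1920·e^{μ L∕8+1}·CK_π L·2(BV L·V + BD L·V)·(2(1+2∕(μ L∕8)))³`, `δH L := μ L∕8`.
* ★★★ `kernel137_pi_family_of_blockLetters` — THE S47 ROW TEXT OF `h137kπ` (the coarse→fine kernel of `Q_k†(K_π⁻¹ − a)`, px10 g13's K3-door ✓`kernel137_family_of_kinvRow` at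
  `Δx := DeltaPiSlotP`) from the same inputs + the coupling pin `|a L i| ≤ A L·((c₀ L∕cB L)·ℓ³)`: `c137 L := 1920·e^{μ L∕8+1}·(CK_π L + A L)`, rate `μ L∕8`.
  After this file the S48 `h133`∕`h137kπ` ∃-packages are the suppliers' ∃-families + `min` of caps + three numeric window lemmas.
HYP-SAT (★★OWNER №42).  Every letter is a row of record with a named landed∕filed supplier; windows are inequalities among L-only letters, inhabited for small `α L` (both LHS are `O(α L)`
at fixed `BV BD Cᵢ CK μ ν δ`); no conclusion-shaped letter.  HONEST SCOPE.  Knits; no estimate of print is proved; nothing of the suppliers' analytic inputs, `norm_G`, the other EX rows,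
EX or the crux is proved; the Yang–Mills mass gap is NOT proved.

References: T. Bałaban, CMP **99** (1985) 389–434 [Balaban1985BackgroundPropagators] ((3.42) p.397, (3.46)–(3.49) pp.398–399, (3.122)–(3.126) p.420, (3.131)–(3.133) pp.421–422, Thm 3.12 p.423);
CMP **102** (1985) 277–309 [Balaban1985Variational] (Thm 1 p.279, (45)–(46) p.285, (103) p.293, (133) p.298).
-/

set_option autoImplicit false

noncomputable section

open scoped BigOperators Matrix.Norms.L2Operator InnerProductSpace ComplexConjugate

namespace Summit.QuantumFields.YangMills.Theorems.Prop7PiSlotRowsOfCone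

open Literature.MathematicalPhysics.QuantumFieldTheory.Balaban1983to89
open Literature.MathematicalPhysics.QuantumFieldTheory.Balaban1983to89.T3ContinuumYM3Torus
open Literature.MathematicalPhysics.QuantumFieldTheory.Balaban1983to89.T3Thm1Carrier
open T3PrintedRegularMinimiser (RegPr)
open T3PrintedMinimiserExistence (regPr_mono)
open T3PrintedRegularOrbits (sites_eq)
open T3LevelShift (siteShift)
open B9SectCLatticeCarrier (Bond)
open B9Eq311L2Pairing (WL2)
open B11Eq103H1Complex (BondL2K)
open B11Eq90V0primeCurrent (flat115)
open B5Eq118OneStroke (iterBlockOf)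
open Summit.QuantumFields.YangMills.Theorems.Prop7SectET3Transport (periodsT3 bondEquiv)
open Summit.QuantumFields.YangMills.Theorems.Prop7SectET3HilbertLetters (W₂ toL2 toL2S toL2B DL2 DstarL2)
open Summit.QuantumFields.YangMills.Theorems.Prop7SectET3GaugeProjector (RS)
open Summit.QuantumFields.YangMills.Theorems.Prop7SectET3WilsonHessian (DeltaEtaSlot)
open Summit.QuantumFields.YangMills.Theorems.Prop7SectET3CurvedPropagators (Qk GT KinvT H1f PosOnto)
open Summit.QuantumFields.YangMills.Theorems.Prop7SectET3DeltaPiPInv (GprimeP DeltaPiSlotP)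
open Summit.QuantumFields.YangMills.Theorems.Prop7Kernel133DoorOfKinvRow (kernel133_family_of_kinvRow_of_greenBlockSup)
open Summit.QuantumFields.YangMills.Theorems.Prop7Kernel133OfPiBlockLetters (blockLetter_mono_rate hGblk_pi_family_of_blockLetters)
open Summit.QuantumFields.YangMills.Theorems.Prop7GreenPiMinusEtaBlockDecay (hDelta_pi_of_blockLetters)
open Summit.QuantumFields.YangMills.Theorems.Prop7KinvPiOfCone (kinvRow_pi_family_of_cone)
open Summit.QuantumFields.YangMills.Theorems.Prop7Kernel137DoorOfKinvEntry (kernel137_family_of_kinvRow)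

/-- ★★ **THE CONE'S `hΔb` FAMILY (Idx edition of N6 FILE D4 ✓`hDelta_pi_of_blockLetters`)**: under the thread, from the five block-letter families, `PosOnto`(Δ^η)∕`PosOnto`(Δ_πᴾ), `0 ≤ a L i`
and D3∕D4's window at `α L`: the block row of `G_π − G₀` for every member with `κ L := α L·κ′_V(L)` at rate `δ L` — part B's `hΔb` binder text.
[cite: Balaban1985BackgroundPropagators, (3.122) p.420, (3.47)–(3.49) pp.398–399, Thm 3.12 p.423] -/
theorem hDelta_pi_family_of_blockLetters
    (α : ℕ → ℝ) (c₀ cB : ℕ → ℝ) [hc₀ : ∀ L : ℕ, Fact (0 < c₀ L)] [hcB : ∀ L : ℕ, Fact (0 < cB L)] (a : ∀ L : ℕ, Idx L → ℝ) (ha : ∀ (L : ℕ) (i : Idx L), 0 ≤ a L i)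
    (Λ : ∀ (L : ℕ) (i : Idx L), GaugeField (i.1.1.P i.1.2.2) 0 (Matrix.specialUnitaryGroup (Fin 2) ℂ) → Prop)
    (hposη : ∀ (L : ℕ), 1 < L → ∀ (i : Idx L) (U₀ : GaugeField (i.1.1.P i.1.2.2) 0 (Matrix.specialUnitaryGroup (Fin 2) ℂ)), ∀ ρ : ℝ, RegPr i.1.1 i.1.2.1 i.1.2.2 ρ U₀ → ρ ≤ α L →
      Λ L i U₀ → PosOnto i.1.1 i.1.2.1 i.1.2.2 i.2.2.le (c₀ L) (cB L) (a L i) (DeltaEtaSlot i.1.1 i.1.2.1 i.1.2.2 (c₀ L)) U₀)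
    (hpos : ∀ (L : ℕ), 1 < L → ∀ (i : Idx L) (U₀ : GaugeField (i.1.1.P i.1.2.2) 0 (Matrix.specialUnitaryGroup (Fin 2) ℂ)), ∀ ρ : ℝ, RegPr i.1.1 i.1.2.1 i.1.2.2 ρ U₀ → ρ ≤ α L →
      Λ L i U₀ → PosOnto i.1.1 i.1.2.1 i.1.2.2 i.2.2.le (c₀ L) (cB L) (a L i) (DeltaPiSlotP i.1.1 i.1.2.1 i.1.2.2 i.2.2.le (c₀ L) (cB L) (a L i)) U₀)
    (BV BD C₁ C₂ C₃ δ δ₁ ν : ℕ → ℝ) (hBV : ∀ L, 1 < L → 0 ≤ BV L) (hBD : ∀ L, 1 < L → 0 ≤ BD L) (hC₁ : ∀ L, 1 < L → 0 ≤ C₁ L) (hC₂ : ∀ L, 1 < L → 0 ≤ C₂ L)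
    (hC₃ : ∀ L, 1 < L → 0 ≤ C₃ L) (hδ : ∀ L, 1 < L → 0 ≤ δ L) (hν : ∀ L, 1 < L → 0 < ν L) (hδ₁ : ∀ L, 1 < L → δ L + ν L ≤ δ₁ L)
    (hGb : ∀ (L : ℕ), 1 < L → ∀ (i : Idx L) (U₀ : GaugeField (i.1.1.P i.1.2.2) 0 (Matrix.specialUnitaryGroup (Fin 2) ℂ)), ∀ ρ : ℝ, RegPr i.1.1 i.1.2.1 i.1.2.2 ρ U₀ → ρ ≤ α L →
      Λ L i U₀ → ∀ (X : PBond (i.1.1.P i.1.2.2) 0 → Matrix (Fin 2) (Fin 2) ℂ) (z : Site (i.1.1.P i.1.2.2) (i.1.2.2 - i.1.2.1)),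
        (∀ b, X b ≠ 0 → iterBlockOf (i.1.2.2 - i.1.2.1) b.src = z) → ∀ s : ℝ, 0 ≤ s → (∀ b, ‖X b‖ ≤ s) →
          ∀ bd : PBond (i.1.1.P i.1.2.2) 0, ‖(toL2 i.1.1 i.1.2.2 (c₀ L)).symm (GT i.1.1 i.1.2.1 i.1.2.2 i.2.2.le (c₀ L) (cB L) (a L i)
              (DeltaEtaSlot i.1.1 i.1.2.1 i.1.2.2 (c₀ L)) U₀ (toL2 i.1.1 i.1.2.2 (c₀ L) X)) bd‖
            ≤ s * BV L * Real.exp (-(δ₁ L * (Site.tdist (P := i.1.1.P i.1.2.2) (iterBlockOf (i.1.2.2 - i.1.2.1) bd.src) z : ℝ))))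
    (hDb : ∀ (L : ℕ), 1 < L → ∀ (i : Idx L) (U₀ : GaugeField (i.1.1.P i.1.2.2) 0 (Matrix.specialUnitaryGroup (Fin 2) ℂ)), ∀ ρ : ℝ, RegPr i.1.1 i.1.2.1 i.1.2.2 ρ U₀ → ρ ≤ α L →
      Λ L i U₀ → ∀ (X : PBond (i.1.1.P i.1.2.2) 0 → Matrix (Fin 2) (Fin 2) ℂ) (z : Site (i.1.1.P i.1.2.2) (i.1.2.2 - i.1.2.1)),
        (∀ b, X b ≠ 0 → iterBlockOf (i.1.2.2 - i.1.2.1) b.src = z) → ∀ s : ℝ, 0 ≤ s → (∀ b, ‖X b‖ ≤ s) →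
          ∀ x : Site (i.1.1.P i.1.2.2) 0, ‖(toL2S i.1.1 i.1.2.2 (c₀ L)).symm (DstarL2 i.1.1 i.1.2.1 i.1.2.2 (c₀ L) U₀ (GT i.1.1 i.1.2.1 i.1.2.2 i.2.2.le (c₀ L) (cB L) (a L i)
              (DeltaEtaSlot i.1.1 i.1.2.1 i.1.2.2 (c₀ L)) U₀ (toL2 i.1.1 i.1.2.2 (c₀ L) X))) x‖
            ≤ s * BD L * Real.exp (-(δ₁ L * (Site.tdist (P := i.1.1.P i.1.2.2) (iterBlockOf (i.1.2.2 - i.1.2.1) x) z : ℝ))))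
    (hc1b : ∀ (L : ℕ), 1 < L → ∀ (i : Idx L) (U₀ : GaugeField (i.1.1.P i.1.2.2) 0 (Matrix.specialUnitaryGroup (Fin 2) ℂ)), ∀ ρ : ℝ, RegPr i.1.1 i.1.2.1 i.1.2.2 ρ U₀ → ρ ≤ α L →
      Λ L i U₀ → ∀ (v : Site (i.1.1.P i.1.2.2) 0 → Matrix (Fin 2) (Fin 2) ℂ) (z : Site (i.1.1.P i.1.2.2) (i.1.2.2 - i.1.2.1)),
        (∀ y, v y ≠ 0 → iterBlockOf (i.1.2.2 - i.1.2.1) y = z) → ∀ m : ℝ, 0 ≤ m → (∀ y, ‖v y‖ ≤ m) →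
          ∀ y : Site (i.1.1.P i.1.2.2) 0, ‖(toL2S i.1.1 i.1.2.2 (c₀ L)).symm (GprimeP i.1.1 i.1.2.1 i.1.2.2 i.2.2.le (c₀ L) (cB L) (a L i) U₀
              (RS i.1.1 i.1.2.1 i.1.2.2 i.2.2.le (c₀ L) (cB L) U₀ (toL2S i.1.1 i.1.2.2 (c₀ L) v))) y‖
            ≤ m * C₁ L * Real.exp (-(δ₁ L * (Site.tdist (P := i.1.1.P i.1.2.2) (iterBlockOf (i.1.2.2 - i.1.2.1) y) z : ℝ))))
    (hc2b : ∀ (L : ℕ), 1 < L → ∀ (i : Idx L) (U₀ : GaugeField (i.1.1.P i.1.2.2) 0 (Matrix.specialUnitaryGroup (Fin 2) ℂ)), ∀ ρ : ℝ, RegPr i.1.1 i.1.2.1 i.1.2.2 ρ U₀ → ρ ≤ α L →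
      Λ L i U₀ → ∀ (v : Site (i.1.1.P i.1.2.2) 0 → Matrix (Fin 2) (Fin 2) ℂ) (z : Site (i.1.1.P i.1.2.2) (i.1.2.2 - i.1.2.1)),
        (∀ y, v y ≠ 0 → iterBlockOf (i.1.2.2 - i.1.2.1) y = z) → ∀ m : ℝ, 0 ≤ m → (∀ y, ‖v y‖ ≤ m) →
          ∀ b : PBond (i.1.1.P i.1.2.2) 0, ‖(toL2 i.1.1 i.1.2.2 (c₀ L)).symm (DL2 i.1.1 i.1.2.1 i.1.2.2 (c₀ L) U₀ (GprimeP i.1.1 i.1.2.1 i.1.2.2 i.2.2.le (c₀ L) (cB L) (a L i) U₀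
              (RS i.1.1 i.1.2.1 i.1.2.2 i.2.2.le (c₀ L) (cB L) U₀ (toL2S i.1.1 i.1.2.2 (c₀ L) v)))) b‖
            ≤ m * C₂ L * Real.exp (-(δ₁ L * (Site.tdist (P := i.1.1.P i.1.2.2) (iterBlockOf (i.1.2.2 - i.1.2.1) b.src) z : ℝ))))
    (hc3b : ∀ (L : ℕ), 1 < L → ∀ (i : Idx L) (U₀ : GaugeField (i.1.1.P i.1.2.2) 0 (Matrix.specialUnitaryGroup (Fin 2) ℂ)), ∀ ρ : ℝ, RegPr i.1.1 i.1.2.1 i.1.2.2 ρ U₀ → ρ ≤ α L →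
      Λ L i U₀ → ∀ (v : Site (i.1.1.P i.1.2.2) 0 → Matrix (Fin 2) (Fin 2) ℂ) (z : Site (i.1.1.P i.1.2.2) (i.1.2.2 - i.1.2.1)),
        (∀ y, v y ≠ 0 → iterBlockOf (i.1.2.2 - i.1.2.1) y = z) → ∀ m : ℝ, 0 ≤ m → (∀ y, ‖v y‖ ≤ m) →
          ∀ y : Site (i.1.1.P i.1.2.2) 0, ‖(toL2S i.1.1 i.1.2.2 (c₀ L)).symm (RS i.1.1 i.1.2.1 i.1.2.2 i.2.2.le (c₀ L) (cB L) U₀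
              (GprimeP i.1.1 i.1.2.1 i.1.2.2 i.2.2.le (c₀ L) (cB L) (a L i) U₀ (toL2S i.1.1 i.1.2.2 (c₀ L) v))) y‖
            ≤ m * C₃ L * Real.exp (-(δ₁ L * (Site.tdist (P := i.1.1.P i.1.2.2) (iterBlockOf (i.1.2.2 - i.1.2.1) y) z : ℝ))))
    (hwin : ∀ L, 1 < L → 2 * (1 + Real.exp (4 * δ L)) * (α L * (C₁ L * (2 * (1 + 1 / ν L)) ^ 3) * (BV L * (2 * (1 + 1 / ν L)) ^ 3 + BD L * (2 * (1 + 1 / ν L)) ^ 3)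
      + 3 * α L * (C₃ L * (2 * (1 + 1 / ν L)) ^ 3) * (1 + C₂ L * (2 * (1 + 1 / ν L)) ^ 3)
        * (1 + C₂ L * (2 * (1 + 1 / ν L)) ^ 3 + 2 * (1 + Real.exp (4 * δ L)) * α L * (C₁ L * (2 * (1 + 1 / ν L)) ^ 3)
          * (BV L * (2 * (1 + 1 / ν L)) ^ 3 + BD L * (2 * (1 + 1 / ν L)) ^ 3))) ≤ 1 / 2) :
    ∀ (L : ℕ), 1 < L → ∀ (i : Idx L) (U₀ : GaugeField (i.1.1.P i.1.2.2) 0 (Matrix.specialUnitaryGroup (Fin 2) ℂ)), ∀ ρ : ℝ, RegPr i.1.1 i.1.2.1 i.1.2.2 ρ U₀ → ρ ≤ α L →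
      Λ L i U₀ → ∀ (X : PBond (i.1.1.P i.1.2.2) 0 → Matrix (Fin 2) (Fin 2) ℂ) (z : Site (i.1.1.P i.1.2.2) (i.1.2.2 - i.1.2.1)),
        (∀ b, X b ≠ 0 → iterBlockOf (i.1.2.2 - i.1.2.1) b.src = z) → ∀ s : ℝ, 0 ≤ s → (∀ b, ‖X b‖ ≤ s) →
          ∀ bd : PBond (i.1.1.P i.1.2.2) 0, ‖(toL2 i.1.1 i.1.2.2 (c₀ L)).symm ((GT i.1.1 i.1.2.1 i.1.2.2 i.2.2.le (c₀ L) (cB L) (a L i)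
              (DeltaPiSlotP i.1.1 i.1.2.1 i.1.2.2 i.2.2.le (c₀ L) (cB L) (a L i)) U₀ - GT i.1.1 i.1.2.1 i.1.2.2 i.2.2.le (c₀ L) (cB L) (a L i) (DeltaEtaSlot i.1.1 i.1.2.1 i.1.2.2 (c₀ L)) U₀)
              (toL2 i.1.1 i.1.2.2 (c₀ L) X)) bd‖
            ≤ s * (α L * (2 * ((BV L * (2 * (1 + 1 / ν L)) ^ 3) + (BD L * (2 * (1 + 1 / ν L)) ^ 3)) * (1 + Real.exp (4 * δ L)) * (2 * (C₁ L * (2 * (1 + 1 / ν L)) ^ 3) * (BV L * (2 * (1 + 1 / ν L)) ^ 3) + 6 * (C₃ L * (2 * (1 + 1 / ν L)) ^ 3) * (1 + (C₂ L * (2 * (1 + 1 / ν L)) ^ 3)) * ((C₂ L * (2 * (1 + 1 / ν L)) ^ 3) + 2 * α L * (1 + Real.exp (4 * δ L)) * (C₁ L * (2 * (1 + 1 / ν L)) ^ 3) * (BV L * (2 * (1 + 1 / ν L)) ^ 3))))) * Real.exp (-(δ L * (Site.tdist (P := i.1.1.P i.1.2.2) (iterBlockOf (i.1.2.2 - i.1.2.1)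 bd.src) z : ℝ))) := by
  intro L hL i U₀ ρ hreg hρ hl
  have hregα : RegPr i.1.1 i.1.2.1 i.1.2.2 (α L) U₀ := regPr_mono (F := i.1.1) hρ hreg
  exact hDelta_pi_of_blockLetters (hδ L hL) (hν L hL) (hδ₁ L hL) U₀ hregα (ha L i) (hposη L hL i U₀ ρ hreg hρ hl) (hpos L hL i U₀ ρ hreg hρ hl)
    (hBV L hL) (hBD L hL) (hC₁ L hL) (hC₂ L hL) (hC₃ L hL) (hGb L hL i U₀ ρ hreg hρ hl) (hDb L hL i U₀ ρ hreg hρ hl) (hc1b L hL i U₀ ρ hreg hρ hl)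
    (hc2b L hL i U₀ ρ hreg hρ hl) (hc3b L hL i U₀ ρ hreg hρ hl) (hwin L hL)

/-- ★★★ **`hKinv`(Π) FOR ALL MEMBERS FROM THE `hKinv`(η) FAMILY AND THE FIVE BLOCK-LETTER FAMILIES**: the doors' `hKinv` family binder at `Δx := DeltaPiSlotP … (a L i)` with
`CK L := (1∕(1 − hcone's LHS))·CK L·3(2(1+8∕μ L))³` at the scaling of record `(c₀ L∕cB L)·ℓ³` and rate `μ L∕8` — part B ✓`kinvRow_pi_family_of_cone` ∘ `hDelta_pi_family_of_blockLetters`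
(`κ L ≥ α L·κ′_V(L)` by monotonicity of the block row in its constant). [cite: Balaban1985BackgroundPropagators, (3.131)–(3.132) pp.421–422, (3.86) p.409; Balaban1985Variational, Thm 1 p.279] -/
theorem kinvRow_pi_family_of_blockLetters
    (α : ℕ → ℝ) (hα : ∀ L : ℕ, 1 < L → 0 < α L) (hW : ∀ L : ℕ, 1 < L → 10 ^ 10 * (L : ℝ) ^ 6 * α L ≤ 1) (hW' : ∀ L : ℕ, 1 < L → 10 ^ 12 * (L : ℝ) ^ 3 * α L ≤ 1)
    (c₀ cB : ℕ → ℝ) [hc₀ : ∀ L : ℕ, Fact (0 < c₀ L)] [hcB : ∀ L : ℕ, Fact (0 < cB L)] (a : ∀ L : ℕ, Idx L → ℝ) (ha : ∀ (L : ℕ) (i : Idx L), 0 ≤ a L i)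
    (Λ : ∀ (L : ℕ) (i : Idx L), GaugeField (i.1.1.P i.1.2.2) 0 (Matrix.specialUnitaryGroup (Fin 2) ℂ) → Prop)
    (hposη : ∀ (L : ℕ), 1 < L → ∀ (i : Idx L) (U₀ : GaugeField (i.1.1.P i.1.2.2) 0 (Matrix.specialUnitaryGroup (Fin 2) ℂ)), ∀ ρ : ℝ, RegPr i.1.1 i.1.2.1 i.1.2.2 ρ U₀ → ρ ≤ α L →
      Λ L i U₀ → PosOnto i.1.1 i.1.2.1 i.1.2.2 i.2.2.le (c₀ L) (cB L) (a L i) (DeltaEtaSlot i.1.1 i.1.2.1 i.1.2.2 (c₀ L)) U₀)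
    (hpos : ∀ (L : ℕ), 1 < L → ∀ (i : Idx L) (U₀ : GaugeField (i.1.1.P i.1.2.2) 0 (Matrix.specialUnitaryGroup (Fin 2) ℂ)), ∀ ρ : ℝ, RegPr i.1.1 i.1.2.1 i.1.2.2 ρ U₀ → ρ ≤ α L →
      Λ L i U₀ → PosOnto i.1.1 i.1.2.1 i.1.2.2 i.2.2.le (c₀ L) (cB L) (a L i) (DeltaPiSlotP i.1.1 i.1.2.1 i.1.2.2 i.2.2.le (c₀ L) (cB L) (a L i)) U₀)
    (BV BD C₁ C₂ C₃ δ δ₁ ν : ℕ → ℝ) (hBV : ∀ L, 1 < L → 0 ≤ BV L) (hBD : ∀ L, 1 < L → 0 ≤ BD L) (hC₁ : ∀ L, 1 < L → 0 ≤ C₁ L) (hC₂ : ∀ L, 1 < L → 0 ≤ C₂ L)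
    (hC₃ : ∀ L, 1 < L → 0 ≤ C₃ L) (hδ : ∀ L, 1 < L → 0 ≤ δ L) (hν : ∀ L, 1 < L → 0 < ν L) (hδ₁ : ∀ L, 1 < L → δ L + ν L ≤ δ₁ L)
    (CK μ κ : ℕ → ℝ) (hCK : ∀ L, 1 < L → 0 ≤ CK L) (hμ : ∀ L, 1 < L → 0 < μ L) (hμδ : ∀ L, 1 < L → 2 * μ L ≤ δ L)
    (hκ : ∀ L, 1 < L → (α L * (2 * ((BV L * (2 * (1 + 1 / ν L)) ^ 3) + (BD L * (2 * (1 + 1 / ν L)) ^ 3)) * (1 + Real.exp (4 * δ L)) * (2 * (C₁ L * (2 * (1 + 1 / ν L)) ^ 3) * (BV L * (2 * (1 + 1 / ν L)) ^ 3) + 6 * (C₃ L * (2 * (1 + 1 / ν L)) ^ 3) * (1 + (C₂ L * (2 * (1 + 1 / ν L)) ^ 3)) * ((C₂ L * (2 * (1 + 1 / ν L)) ^ 3) + 2 * α L * (1 + Real.exp (4 * δ L)) * (C₁ L * (2 * (1 + 1 / ν L)) ^ 3) * (BV L * (2 * (1 + 1 / ν L)) ^ 3))))) ≤ κ L)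
    (hKinv : ∀ (L : ℕ), 1 < L → ∀ (i : Idx L) (U₀ : GaugeField (i.1.1.P i.1.2.2) 0 (Matrix.specialUnitaryGroup (Fin 2) ℂ)), ∀ ρ : ℝ, RegPr i.1.1 i.1.2.1 i.1.2.2 ρ U₀ → ρ ≤ α L →
      Λ L i U₀ → ∀ (y : PBond (i.1.1.P i.1.2.1) 0) (Z : Matrix (Fin 2) (Fin 2) ℂ) (y' : PBond (i.1.1.P i.1.2.1) 0),
        ‖(toL2B i.1.1 i.1.2.1 (cB L)).symm (KinvT i.1.1 i.1.2.1 i.1.2.2 i.2.2.le (c₀ L) (cB L) (a L i) (DeltaEtaSlot i.1.1 i.1.2.1 i.1.2.2 (c₀ L)) U₀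
            (toL2B i.1.1 i.1.2.1 (cB L) (Pi.single y Z))) y'‖
          ≤ CK L * ((c₀ L / cB L) * ((L : ℝ) ^ (i.1.2.2 - i.1.2.1)) ^ 3)
              * Real.exp (-(μ L * (Site.tdist (siteShift (sites_eq i.1.1 i.1.2.1 i.1.2.2 i.2.2.le) y'.src) (siteShift (sites_eq i.1.1 i.1.2.1 i.1.2.2 i.2.2.le) y.src) : ℝ))) * ‖Z‖)
    (hGb : ∀ (L : ℕ), 1 < L → ∀ (i : Idx L) (U₀ : GaugeField (i.1.1.P i.1.2.2) 0 (Matrix.specialUnitaryGroup (Fin 2) ℂ)), ∀ ρ : ℝ, RegPr i.1.1 i.1.2.1 i.1.2.2 ρ U₀ → ρ ≤ α L →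
      Λ L i U₀ → ∀ (X : PBond (i.1.1.P i.1.2.2) 0 → Matrix (Fin 2) (Fin 2) ℂ) (z : Site (i.1.1.P i.1.2.2) (i.1.2.2 - i.1.2.1)),
        (∀ b, X b ≠ 0 → iterBlockOf (i.1.2.2 - i.1.2.1) b.src = z) → ∀ s : ℝ, 0 ≤ s → (∀ b, ‖X b‖ ≤ s) →
          ∀ bd : PBond (i.1.1.P i.1.2.2) 0, ‖(toL2 i.1.1 i.1.2.2 (c₀ L)).symm (GT i.1.1 i.1.2.1 i.1.2.2 i.2.2.le (c₀ L) (cB L) (a L i)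
              (DeltaEtaSlot i.1.1 i.1.2.1 i.1.2.2 (c₀ L)) U₀ (toL2 i.1.1 i.1.2.2 (c₀ L) X)) bd‖
            ≤ s * BV L * Real.exp (-(δ₁ L * (Site.tdist (P := i.1.1.P i.1.2.2) (iterBlockOf (i.1.2.2 - i.1.2.1) bd.src) z : ℝ))))
    (hDb : ∀ (L : ℕ), 1 < L → ∀ (i : Idx L) (U₀ : GaugeField (i.1.1.P i.1.2.2) 0 (Matrix.specialUnitaryGroup (Fin 2) ℂ)), ∀ ρ : ℝ, RegPr i.1.1 i.1.2.1 i.1.2.2 ρ U₀ → ρ ≤ α L →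
      Λ L i U₀ → ∀ (X : PBond (i.1.1.P i.1.2.2) 0 → Matrix (Fin 2) (Fin 2) ℂ) (z : Site (i.1.1.P i.1.2.2) (i.1.2.2 - i.1.2.1)),
        (∀ b, X b ≠ 0 → iterBlockOf (i.1.2.2 - i.1.2.1) b.src = z) → ∀ s : ℝ, 0 ≤ s → (∀ b, ‖X b‖ ≤ s) →
          ∀ x : Site (i.1.1.P i.1.2.2) 0, ‖(toL2S i.1.1 i.1.2.2 (c₀ L)).symm (DstarL2 i.1.1 i.1.2.1 i.1.2.2 (c₀ L) U₀ (GT i.1.1 i.1.2.1 i.1.2.2 i.2.2.le (c₀ L) (cB L) (a L i)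
              (DeltaEtaSlot i.1.1 i.1.2.1 i.1.2.2 (c₀ L)) U₀ (toL2 i.1.1 i.1.2.2 (c₀ L) X))) x‖
            ≤ s * BD L * Real.exp (-(δ₁ L * (Site.tdist (P := i.1.1.P i.1.2.2) (iterBlockOf (i.1.2.2 - i.1.2.1) x) z : ℝ))))
    (hc1b : ∀ (L : ℕ), 1 < L → ∀ (i : Idx L) (U₀ : GaugeField (i.1.1.P i.1.2.2) 0 (Matrix.specialUnitaryGroup (Fin 2) ℂ)), ∀ ρ : ℝ, RegPr i.1.1 i.1.2.1 i.1.2.2 ρ U₀ → ρ ≤ α L →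
      Λ L i U₀ → ∀ (v : Site (i.1.1.P i.1.2.2) 0 → Matrix (Fin 2) (Fin 2) ℂ) (z : Site (i.1.1.P i.1.2.2) (i.1.2.2 - i.1.2.1)),
        (∀ y, v y ≠ 0 → iterBlockOf (i.1.2.2 - i.1.2.1) y = z) → ∀ m : ℝ, 0 ≤ m → (∀ y, ‖v y‖ ≤ m) →
          ∀ y : Site (i.1.1.P i.1.2.2) 0, ‖(toL2S i.1.1 i.1.2.2 (c₀ L)).symm (GprimeP i.1.1 i.1.2.1 i.1.2.2 i.2.2.le (c₀ L) (cB L) (a L i) U₀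
              (RS i.1.1 i.1.2.1 i.1.2.2 i.2.2.le (c₀ L) (cB L) U₀ (toL2S i.1.1 i.1.2.2 (c₀ L) v))) y‖
            ≤ m * C₁ L * Real.exp (-(δ₁ L * (Site.tdist (P := i.1.1.P i.1.2.2) (iterBlockOf (i.1.2.2 - i.1.2.1) y) z : ℝ))))
    (hc2b : ∀ (L : ℕ), 1 < L → ∀ (i : Idx L) (U₀ : GaugeField (i.1.1.P i.1.2.2) 0 (Matrix.specialUnitaryGroup (Fin 2) ℂ)), ∀ ρ : ℝ, RegPr i.1.1 i.1.2.1 i.1.2.2 ρ U₀ → ρ ≤ α L →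
      Λ L i U₀ → ∀ (v : Site (i.1.1.P i.1.2.2) 0 → Matrix (Fin 2) (Fin 2) ℂ) (z : Site (i.1.1.P i.1.2.2) (i.1.2.2 - i.1.2.1)),
        (∀ y, v y ≠ 0 → iterBlockOf (i.1.2.2 - i.1.2.1) y = z) → ∀ m : ℝ, 0 ≤ m → (∀ y, ‖v y‖ ≤ m) →
          ∀ b : PBond (i.1.1.P i.1.2.2) 0, ‖(toL2 i.1.1 i.1.2.2 (c₀ L)).symm (DL2 i.1.1 i.1.2.1 i.1.2.2 (c₀ L) U₀ (GprimeP i.1.1 i.1.2.1 i.1.2.2 i.2.2.le (c₀ L) (cB L) (a L i) U₀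
              (RS i.1.1 i.1.2.1 i.1.2.2 i.2.2.le (c₀ L) (cB L) U₀ (toL2S i.1.1 i.1.2.2 (c₀ L) v)))) b‖
            ≤ m * C₂ L * Real.exp (-(δ₁ L * (Site.tdist (P := i.1.1.P i.1.2.2) (iterBlockOf (i.1.2.2 - i.1.2.1) b.src) z : ℝ))))
    (hc3b : ∀ (L : ℕ), 1 < L → ∀ (i : Idx L) (U₀ : GaugeField (i.1.1.P i.1.2.2) 0 (Matrix.specialUnitaryGroup (Fin 2) ℂ)), ∀ ρ : ℝ, RegPr i.1.1 i.1.2.1 i.1.2.2 ρ U₀ → ρ ≤ α L →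
      Λ L i U₀ → ∀ (v : Site (i.1.1.P i.1.2.2) 0 → Matrix (Fin 2) (Fin 2) ℂ) (z : Site (i.1.1.P i.1.2.2) (i.1.2.2 - i.1.2.1)),
        (∀ y, v y ≠ 0 → iterBlockOf (i.1.2.2 - i.1.2.1) y = z) → ∀ m : ℝ, 0 ≤ m → (∀ y, ‖v y‖ ≤ m) →
          ∀ y : Site (i.1.1.P i.1.2.2) 0, ‖(toL2S i.1.1 i.1.2.2 (c₀ L)).symm (RS i.1.1 i.1.2.1 i.1.2.2 i.2.2.le (c₀ L) (cB L) U₀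
              (GprimeP i.1.1 i.1.2.1 i.1.2.2 i.2.2.le (c₀ L) (cB L) (a L i) U₀ (toL2S i.1.1 i.1.2.2 (c₀ L) v))) y‖
            ≤ m * C₃ L * Real.exp (-(δ₁ L * (Site.tdist (P := i.1.1.P i.1.2.2) (iterBlockOf (i.1.2.2 - i.1.2.1) y) z : ℝ))))
    (hwin : ∀ L, 1 < L → 2 * (1 + Real.exp (4 * δ L)) * (α L * (C₁ L * (2 * (1 + 1 / ν L)) ^ 3) * (BV L * (2 * (1 + 1 / ν L)) ^ 3 + BD L * (2 * (1 + 1 / ν L)) ^ 3)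
      + 3 * α L * (C₃ L * (2 * (1 + 1 / ν L)) ^ 3) * (1 + C₂ L * (2 * (1 + 1 / ν L)) ^ 3)
        * (1 + C₂ L * (2 * (1 + 1 / ν L)) ^ 3 + 2 * (1 + Real.exp (4 * δ L)) * α L * (C₁ L * (2 * (1 + 1 / ν L)) ^ 3)
          * (BV L * (2 * (1 + 1 / ν L)) ^ 3 + BD L * (2 * (1 + 1 / ν L)) ^ 3))) ≤ 1 / 2)
    (hcone : ∀ L, 1 < L → CK L * (9600 * Real.exp (2 * μ L + 1) * κ L * (2 * (1 + 1 / μ L)) ^ 3) * (3 * (2 * (1 + 2 / μ L)) ^ 3) * (3 * (2 * (1 + 4 / μ L)) ^ 3) < 1) :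
    ∀ (L : ℕ), 1 < L → ∀ (i : Idx L) (U₀ : GaugeField (i.1.1.P i.1.2.2) 0 (Matrix.specialUnitaryGroup (Fin 2) ℂ)), ∀ ρ : ℝ, RegPr i.1.1 i.1.2.1 i.1.2.2 ρ U₀ → ρ ≤ α L →
      Λ L i U₀ → ∀ (y : PBond (i.1.1.P i.1.2.1) 0) (Z : Matrix (Fin 2) (Fin 2) ℂ) (y' : PBond (i.1.1.P i.1.2.1) 0),
        ‖(toL2B i.1.1 i.1.2.1 (cB L)).symm (KinvT i.1.1 i.1.2.1 i.1.2.2 i.2.2.le (c₀ L) (cB L) (a L i) (DeltaPiSlotP i.1.1 i.1.2.1 i.1.2.2 i.2.2.le (c₀ L) (cB L) (a L i)) U₀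
            (toL2B i.1.1 i.1.2.1 (cB L) (Pi.single y Z))) y'‖
          ≤ ((1 / (1 - CK L * (9600 * Real.exp (2 * μ L + 1) * κ L * (2 * (1 + 1 / μ L)) ^ 3) * (3 * (2 * (1 + 2 / μ L)) ^ 3) * (3 * (2 * (1 + 4 / μ L)) ^ 3))) * CK L * (3 * (2 * (1 + 8 / μ L)) ^ 3)) * ((c₀ L / cB L) * ((L : ℝ) ^ (i.1.2.2 - i.1.2.1)) ^ 3)
              * Real.exp (-(μ L / 8 * (Site.tdist (siteShift (sites_eq i.1.1 i.1.2.1 i.1.2.2 i.2.2.le) y'.src) (siteShift (sites_eq i.1.1 i.1.2.1 i.1.2.2 i.2.2.le) y.src) : ℝ))) * ‖Z‖ := by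
  have hΔ := hDelta_pi_family_of_blockLetters α c₀ cB a ha Λ hposη hpos BV BD C₁ C₂ C₃ δ δ₁ ν hBV hBD hC₁ hC₂ hC₃ hδ hν hδ₁ hGb hDb hc1b hc2b hc3b hwin
  have hκ0 : ∀ L, 1 < L → 0 ≤ κ L := fun L hL => by
    have := hα L hL; have := hBV L hL; have := hBD L hL; have := hC₁ L hL; have := hC₂ L hL; have := hC₃ L hL; have := hν L hL
    exact le_trans (by positivity) (hκ L hL)
  refine kinvRow_pi_family_of_cone α hα hW hW' c₀ cB a Λ hposη hpos CK μ κ δ hCK hμ hκ0 hμδ hKinv (fun L hL i U₀ ρ hreg hρ hl X z hXz s hs hX bd => ?_) hcone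
  exact (hΔ L hL i U₀ ρ hreg hρ hl X z hXz s hs hX bd).trans
    (mul_le_mul_of_nonneg_right (mul_le_mul_of_nonneg_left (hκ L hL) hs) (Real.exp_pos _).le)

/-- ★★★ **THE S47 ROW `h133` FOR ALL MEMBERS FROM THE `hKinv`(η) FAMILY AND THE FIVE BLOCK-LETTER FAMILIES** (the Π-slot knit): ✓`kernel133_family_of_kinvRow_of_greenBlockSup` (H-door §4)
fed `kinvRow_pi_family_of_blockLetters` and the H-KNIT's ✓`hGblk_pi_family_of_blockLetters` with its rate lowered `δ L → μ L∕8` (✓`blockLetter_mono_rate`); `CH L` and `δH L := μ L∕8` as displayed,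
NO `η`-power. [cite: Balaban1985BackgroundPropagators, (3.133) p.422, Thm 3.12 p.423, (3.126) p.420; Balaban1985Variational, (45)–(46) p.285, (103) p.293, (133) p.298] -/
theorem kernel133_family_of_kinvRowEta_of_piBlockLetters
    [hFL : ∀ F : T3Family, Fact (0 < (F.L : ℝ))] [hFη : ∀ (F : T3Family) (k : ℕ), Fact (0 < ((F.L : ℝ)⁻¹) ^ k)]
    (α : ℕ → ℝ) (hα : ∀ L : ℕ, 1 < L → 0 < α L) (hW : ∀ L : ℕ, 1 < L → 10 ^ 10 * (L : ℝ) ^ 6 * α L ≤ 1) (hW' : ∀ L : ℕ, 1 < L → 10 ^ 12 * (L : ℝ) ^ 3 * α L ≤ 1)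
    (c₀ cB : ℕ → ℝ) [hc₀ : ∀ L : ℕ, Fact (0 < c₀ L)] [hcB : ∀ L : ℕ, Fact (0 < cB L)] (a : ∀ L : ℕ, Idx L → ℝ) (ha : ∀ (L : ℕ) (i : Idx L), 0 ≤ a L i)
    (Λ : ∀ (L : ℕ) (i : Idx L), GaugeField (i.1.1.P i.1.2.2) 0 (Matrix.specialUnitaryGroup (Fin 2) ℂ) → Prop)
    (hposη : ∀ (L : ℕ), 1 < L → ∀ (i : Idx L) (U₀ : GaugeField (i.1.1.P i.1.2.2) 0 (Matrix.specialUnitaryGroup (Fin 2) ℂ)), ∀ ρ : ℝ, RegPr i.1.1 i.1.2.1 i.1.2.2 ρ U₀ → ρ ≤ α L →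
      Λ L i U₀ → PosOnto i.1.1 i.1.2.1 i.1.2.2 i.2.2.le (c₀ L) (cB L) (a L i) (DeltaEtaSlot i.1.1 i.1.2.1 i.1.2.2 (c₀ L)) U₀)
    (hpos : ∀ (L : ℕ), 1 < L → ∀ (i : Idx L) (U₀ : GaugeField (i.1.1.P i.1.2.2) 0 (Matrix.specialUnitaryGroup (Fin 2) ℂ)), ∀ ρ : ℝ, RegPr i.1.1 i.1.2.1 i.1.2.2 ρ U₀ → ρ ≤ α L →
      Λ L i U₀ → PosOnto i.1.1 i.1.2.1 i.1.2.2 i.2.2.le (c₀ L) (cB L) (a L i) (DeltaPiSlotP i.1.1 i.1.2.1 i.1.2.2 i.2.2.le (c₀ L) (cB L) (a L i)) U₀)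
    (BV BD C₁ C₂ C₃ δ δ₁ ν : ℕ → ℝ) (hBV : ∀ L, 1 < L → 0 ≤ BV L) (hBD : ∀ L, 1 < L → 0 ≤ BD L) (hC₁ : ∀ L, 1 < L → 0 ≤ C₁ L) (hC₂ : ∀ L, 1 < L → 0 ≤ C₂ L)
    (hC₃ : ∀ L, 1 < L → 0 ≤ C₃ L) (hδ : ∀ L, 1 < L → 0 ≤ δ L) (hν : ∀ L, 1 < L → 0 < ν L) (hδ₁ : ∀ L, 1 < L → δ L + ν L ≤ δ₁ L)
    (CK μ κ : ℕ → ℝ) (hCK : ∀ L, 1 < L → 0 ≤ CK L) (hμ : ∀ L, 1 < L → 0 < μ L) (hμδ : ∀ L, 1 < L → 2 * μ L ≤ δ L)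
    (hκ : ∀ L, 1 < L → (α L * (2 * ((BV L * (2 * (1 + 1 / ν L)) ^ 3) + (BD L * (2 * (1 + 1 / ν L)) ^ 3)) * (1 + Real.exp (4 * δ L)) * (2 * (C₁ L * (2 * (1 + 1 / ν L)) ^ 3) * (BV L * (2 * (1 + 1 / ν L)) ^ 3) + 6 * (C₃ L * (2 * (1 + 1 / ν L)) ^ 3) * (1 + (C₂ L * (2 * (1 + 1 / ν L)) ^ 3)) * ((C₂ L * (2 * (1 + 1 / ν L)) ^ 3) + 2 * α L * (1 + Real.exp (4 * δ L)) * (C₁ L * (2 * (1 + 1 / ν L)) ^ 3) * (BV L * (2 * (1 + 1 / ν L)) ^ 3))))) ≤ κ L)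
    (hKinv : ∀ (L : ℕ), 1 < L → ∀ (i : Idx L) (U₀ : GaugeField (i.1.1.P i.1.2.2) 0 (Matrix.specialUnitaryGroup (Fin 2) ℂ)), ∀ ρ : ℝ, RegPr i.1.1 i.1.2.1 i.1.2.2 ρ U₀ → ρ ≤ α L →
      Λ L i U₀ → ∀ (y : PBond (i.1.1.P i.1.2.1) 0) (Z : Matrix (Fin 2) (Fin 2) ℂ) (y' : PBond (i.1.1.P i.1.2.1) 0),
        ‖(toL2B i.1.1 i.1.2.1 (cB L)).symm (KinvT i.1.1 i.1.2.1 i.1.2.2 i.2.2.le (c₀ L) (cB L) (a L i) (DeltaEtaSlot i.1.1 i.1.2.1 i.1.2.2 (c₀ L)) U₀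
            (toL2B i.1.1 i.1.2.1 (cB L) (Pi.single y Z))) y'‖
          ≤ CK L * ((c₀ L / cB L) * ((L : ℝ) ^ (i.1.2.2 - i.1.2.1)) ^ 3)
              * Real.exp (-(μ L * (Site.tdist (siteShift (sites_eq i.1.1 i.1.2.1 i.1.2.2 i.2.2.le) y'.src) (siteShift (sites_eq i.1.1 i.1.2.1 i.1.2.2 i.2.2.le) y.src) : ℝ))) * ‖Z‖)
    (hGb : ∀ (L : ℕ), 1 < L → ∀ (i : Idx L) (U₀ : GaugeField (i.1.1.P i.1.2.2) 0 (Matrix.specialUnitaryGroup (Fin 2) ℂ)), ∀ ρ : ℝ, RegPr i.1.1 i.1.2.1 i.1.2.2 ρ U₀ → ρ ≤ α L →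
      Λ L i U₀ → ∀ (X : PBond (i.1.1.P i.1.2.2) 0 → Matrix (Fin 2) (Fin 2) ℂ) (z : Site (i.1.1.P i.1.2.2) (i.1.2.2 - i.1.2.1)),
        (∀ b, X b ≠ 0 → iterBlockOf (i.1.2.2 - i.1.2.1) b.src = z) → ∀ s : ℝ, 0 ≤ s → (∀ b, ‖X b‖ ≤ s) →
          ∀ bd : PBond (i.1.1.P i.1.2.2) 0, ‖(toL2 i.1.1 i.1.2.2 (c₀ L)).symm (GT i.1.1 i.1.2.1 i.1.2.2 i.2.2.le (c₀ L) (cB L) (a L i)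
              (DeltaEtaSlot i.1.1 i.1.2.1 i.1.2.2 (c₀ L)) U₀ (toL2 i.1.1 i.1.2.2 (c₀ L) X)) bd‖
            ≤ s * BV L * Real.exp (-(δ₁ L * (Site.tdist (P := i.1.1.P i.1.2.2) (iterBlockOf (i.1.2.2 - i.1.2.1) bd.src) z : ℝ))))
    (hDb : ∀ (L : ℕ), 1 < L → ∀ (i : Idx L) (U₀ : GaugeField (i.1.1.P i.1.2.2) 0 (Matrix.specialUnitaryGroup (Fin 2) ℂ)), ∀ ρ : ℝ, RegPr i.1.1 i.1.2.1 i.1.2.2 ρ U₀ → ρ ≤ α L →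
      Λ L i U₀ → ∀ (X : PBond (i.1.1.P i.1.2.2) 0 → Matrix (Fin 2) (Fin 2) ℂ) (z : Site (i.1.1.P i.1.2.2) (i.1.2.2 - i.1.2.1)),
        (∀ b, X b ≠ 0 → iterBlockOf (i.1.2.2 - i.1.2.1) b.src = z) → ∀ s : ℝ, 0 ≤ s → (∀ b, ‖X b‖ ≤ s) →
          ∀ x : Site (i.1.1.P i.1.2.2) 0, ‖(toL2S i.1.1 i.1.2.2 (c₀ L)).symm (DstarL2 i.1.1 i.1.2.1 i.1.2.2 (c₀ L) U₀ (GT i.1.1 i.1.2.1 i.1.2.2 i.2.2.le (c₀ L) (cB L) (a L i)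
              (DeltaEtaSlot i.1.1 i.1.2.1 i.1.2.2 (c₀ L)) U₀ (toL2 i.1.1 i.1.2.2 (c₀ L) X))) x‖
            ≤ s * BD L * Real.exp (-(δ₁ L * (Site.tdist (P := i.1.1.P i.1.2.2) (iterBlockOf (i.1.2.2 - i.1.2.1) x) z : ℝ))))
    (hc1b : ∀ (L : ℕ), 1 < L → ∀ (i : Idx L) (U₀ : GaugeField (i.1.1.P i.1.2.2) 0 (Matrix.specialUnitaryGroup (Fin 2) ℂ)), ∀ ρ : ℝ, RegPr i.1.1 i.1.2.1 i.1.2.2 ρ U₀ → ρ ≤ α L →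
      Λ L i U₀ → ∀ (v : Site (i.1.1.P i.1.2.2) 0 → Matrix (Fin 2) (Fin 2) ℂ) (z : Site (i.1.1.P i.1.2.2) (i.1.2.2 - i.1.2.1)),
        (∀ y, v y ≠ 0 → iterBlockOf (i.1.2.2 - i.1.2.1) y = z) → ∀ m : ℝ, 0 ≤ m → (∀ y, ‖v y‖ ≤ m) →
          ∀ y : Site (i.1.1.P i.1.2.2) 0, ‖(toL2S i.1.1 i.1.2.2 (c₀ L)).symm (GprimeP i.1.1 i.1.2.1 i.1.2.2 i.2.2.le (c₀ L) (cB L) (a L i) U₀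
              (RS i.1.1 i.1.2.1 i.1.2.2 i.2.2.le (c₀ L) (cB L) U₀ (toL2S i.1.1 i.1.2.2 (c₀ L) v))) y‖
            ≤ m * C₁ L * Real.exp (-(δ₁ L * (Site.tdist (P := i.1.1.P i.1.2.2) (iterBlockOf (i.1.2.2 - i.1.2.1) y) z : ℝ))))
    (hc2b : ∀ (L : ℕ), 1 < L → ∀ (i : Idx L) (U₀ : GaugeField (i.1.1.P i.1.2.2) 0 (Matrix.specialUnitaryGroup (Fin 2) ℂ)), ∀ ρ : ℝ, RegPr i.1.1 i.1.2.1 i.1.2.2 ρ U₀ → ρ ≤ α L →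
      Λ L i U₀ → ∀ (v : Site (i.1.1.P i.1.2.2) 0 → Matrix (Fin 2) (Fin 2) ℂ) (z : Site (i.1.1.P i.1.2.2) (i.1.2.2 - i.1.2.1)),
        (∀ y, v y ≠ 0 → iterBlockOf (i.1.2.2 - i.1.2.1) y = z) → ∀ m : ℝ, 0 ≤ m → (∀ y, ‖v y‖ ≤ m) →
          ∀ b : PBond (i.1.1.P i.1.2.2) 0, ‖(toL2 i.1.1 i.1.2.2 (c₀ L)).symm (DL2 i.1.1 i.1.2.1 i.1.2.2 (c₀ L) U₀ (GprimeP i.1.1 i.1.2.1 i.1.2.2 i.2.2.le (c₀ L) (cB L) (a L i) U₀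
              (RS i.1.1 i.1.2.1 i.1.2.2 i.2.2.le (c₀ L) (cB L) U₀ (toL2S i.1.1 i.1.2.2 (c₀ L) v)))) b‖
            ≤ m * C₂ L * Real.exp (-(δ₁ L * (Site.tdist (P := i.1.1.P i.1.2.2) (iterBlockOf (i.1.2.2 - i.1.2.1) b.src) z : ℝ))))
    (hc3b : ∀ (L : ℕ), 1 < L → ∀ (i : Idx L) (U₀ : GaugeField (i.1.1.P i.1.2.2) 0 (Matrix.specialUnitaryGroup (Fin 2) ℂ)), ∀ ρ : ℝ, RegPr i.1.1 i.1.2.1 i.1.2.2 ρ U₀ → ρ ≤ α L →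
      Λ L i U₀ → ∀ (v : Site (i.1.1.P i.1.2.2) 0 → Matrix (Fin 2) (Fin 2) ℂ) (z : Site (i.1.1.P i.1.2.2) (i.1.2.2 - i.1.2.1)),
        (∀ y, v y ≠ 0 → iterBlockOf (i.1.2.2 - i.1.2.1) y = z) → ∀ m : ℝ, 0 ≤ m → (∀ y, ‖v y‖ ≤ m) →
          ∀ y : Site (i.1.1.P i.1.2.2) 0, ‖(toL2S i.1.1 i.1.2.2 (c₀ L)).symm (RS i.1.1 i.1.2.1 i.1.2.2 i.2.2.le (c₀ L) (cB L) U₀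
              (GprimeP i.1.1 i.1.2.1 i.1.2.2 i.2.2.le (c₀ L) (cB L) (a L i) U₀ (toL2S i.1.1 i.1.2.2 (c₀ L) v))) y‖
            ≤ m * C₃ L * Real.exp (-(δ₁ L * (Site.tdist (P := i.1.1.P i.1.2.2) (iterBlockOf (i.1.2.2 - i.1.2.1) y) z : ℝ))))
    (hwin : ∀ L, 1 < L → 2 * (1 + Real.exp (4 * δ L)) * (α L * (C₁ L * (2 * (1 + 1 / ν L)) ^ 3) * (BV L * (2 * (1 + 1 / ν L)) ^ 3 + BD L * (2 * (1 + 1 / ν L)) ^ 3)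
      + 3 * α L * (C₃ L * (2 * (1 + 1 / ν L)) ^ 3) * (1 + C₂ L * (2 * (1 + 1 / ν L)) ^ 3)
        * (1 + C₂ L * (2 * (1 + 1 / ν L)) ^ 3 + 2 * (1 + Real.exp (4 * δ L)) * α L * (C₁ L * (2 * (1 + 1 / ν L)) ^ 3)
          * (BV L * (2 * (1 + 1 / ν L)) ^ 3 + BD L * (2 * (1 + 1 / ν L)) ^ 3))) ≤ 1 / 2)
    (hcone : ∀ L, 1 < L → CK L * (9600 * Real.exp (2 * μ L + 1) * κ L * (2 * (1 + 1 / μ L)) ^ 3) * (3 * (2 * (1 + 2 / μ L)) ^ 3) * (3 * (2 * (1 + 4 / μ L)) ^ 3) < 1) :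
    ∀ (L : ℕ), 1 < L → ∀ (i : Idx L) (U₀ : GaugeField (i.1.1.P i.1.2.2) 0 (Matrix.specialUnitaryGroup (Fin 2) ℂ)), ∀ ρ : ℝ, RegPr i.1.1 i.1.2.1 i.1.2.2 ρ U₀ → ρ ≤ α L →
      Λ L i U₀ → ∀ (y : PBond (i.1.1.P i.1.2.1) 0) (Z : Matrix (Fin 2) (Fin 2) ℂ) (b' : Bond 3 (periodsT3 i.1.1 i.1.2.2)),
        ‖flat115 ((H1f i.1.1 i.1.2.1 i.1.2.2 i.2.2.le (c₀ L) (cB L) (a L i) (DeltaPiSlotP i.1.1 i.1.2.1 i.1.2.2 i.2.2.le (c₀ L) (cB L) (a L i)) U₀) (Pi.single y Z)) b'‖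
          ≤ (1920 * Real.exp (μ L / 8 + 1) * ((1 / (1 - CK L * (9600 * Real.exp (2 * μ L + 1) * κ L * (2 * (1 + 1 / μ L)) ^ 3) * (3 * (2 * (1 + 2 / μ L)) ^ 3) * (3 * (2 * (1 + 4 / μ L)) ^ 3))) * CK L * (3 * (2 * (1 + 8 / μ L)) ^ 3)) * (2 * (BV L * (2 * (1 + 1 / ν L)) ^ 3 + BD L * (2 * (1 + 1 / ν L)) ^ 3)) * (2 * (1 + 2 / (μ L / 8))) ^ 3)
              * Real.exp (-(μ L / 8 / 2 * (Site.tdist (B5Eq118OneStroke.iterBlockOf (i.1.2.2 - i.1.2.1) ((bondEquiv i.1.1 i.1.2.2).symm b').src)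
                  (T3LevelShift.siteShift (T3PrintedRegularOrbits.sites_eq i.1.1 i.1.2.1 i.1.2.2 i.2.2.le) y.src) : ℝ))) * ‖Z‖ := by
  have hKπ := kinvRow_pi_family_of_blockLetters α hα hW hW' c₀ cB a ha Λ hposη hpos BV BD C₁ C₂ C₃ δ δ₁ ν hBV hBD hC₁ hC₂ hC₃ hδ hν hδ₁ CK μ κ hCK hμ hμδ hκ hKinv
    hGb hDb hc1b hc2b hc3b hwin hcone
  have hG := hGblk_pi_family_of_blockLetters α c₀ cB a ha Λ hposη hpos BV BD C₁ C₂ C₃ δ δ₁ ν hBV hBD hC₁ hC₂ hC₃ hδ hν hδ₁ hGb hDb hc1b hc2b hc3b hwin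
  have hκ0 : ∀ L, 1 < L → 0 ≤ κ L := fun L hL => by
    have := hα L hL; have := hBV L hL; have := hBD L hL; have := hC₁ L hL; have := hC₂ L hL; have := hC₃ L hL; have := hν L hL
    exact le_trans (by positivity) (hκ L hL)
  have hCKπ : ∀ L, 1 < L → 0 ≤ ((1 / (1 - CK L * (9600 * Real.exp (2 * μ L + 1) * κ L * (2 * (1 + 1 / μ L)) ^ 3) * (3 * (2 * (1 + 2 / μ L)) ^ 3) * (3 * (2 * (1 + 4 / μ L)) ^ 3))) * CK L * (3 * (2 * (1 + 8 / μ L)) ^ 3)) := fun L hL => by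
    have := hCK L hL; have := hμ L hL; have := hκ0 L hL; have h1 := hcone L hL
    exact mul_nonneg (mul_nonneg (div_nonneg one_pos.le (by linarith)) (hCK L hL)) (by positivity)
  refine kernel133_family_of_kinvRow_of_greenBlockSup α hα hW hW' c₀ cB a Λ hpos
    (fun L => ((1 / (1 - CK L * (9600 * Real.exp (2 * μ L + 1) * κ L * (2 * (1 + 1 / μ L)) ^ 3) * (3 * (2 * (1 + 2 / μ L)) ^ 3) * (3 * (2 * (1 + 4 / μ L)) ^ 3))) * CK L * (3 * (2 * (1 + 8 / μ L)) ^ 3)))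
    (fun L => (2 * (BV L * (2 * (1 + 1 / ν L)) ^ 3 + BD L * (2 * (1 + 1 / ν L)) ^ 3))) (fun L => μ L / 8) hCKπ
    (fun L hL => by have := hBV L hL; have := hBD L hL; have := hν L hL; positivity) (fun L hL => by have := hμ L hL; positivity) hKπ
    (fun L hL i U₀ ρ hreg hρ hl => ?_)
  have hle : μ L / 8 ≤ δ L := by have := hμ L hL; have := hμδ L hL; linarith
  have hCG : 0 ≤ (2 * (BV L * (2 * (1 + 1 / ν L)) ^ 3 + BD L * (2 * (1 + 1 / ν L)) ^ 3)) := by have := hBV L hL; have := hBD L hL; have := hν L hL; positivity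
  exact blockLetter_mono_rate (fun b : PBond (i.1.1.P i.1.2.2) 0 => iterBlockOf (i.1.2.2 - i.1.2.1) b.src) (fun bd : PBond (i.1.1.P i.1.2.2) 0 => iterBlockOf (i.1.2.2 - i.1.2.1) bd.src)
    (fun X bd => (toL2 i.1.1 i.1.2.2 (c₀ L)).symm (GT i.1.1 i.1.2.1 i.1.2.2 i.2.2.le (c₀ L) (cB L) (a L i)
      (DeltaPiSlotP i.1.1 i.1.2.1 i.1.2.2 i.2.2.le (c₀ L) (cB L) (a L i)) U₀ (toL2 i.1.1 i.1.2.2 (c₀ L) X)) bd) hCG hle (hG L hL i U₀ ρ hreg hρ hl)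

/-- ★★★ **THE S47 ROW `h137kπ` FOR ALL MEMBERS FROM THE `hKinv`(η) FAMILY, THE FIVE BLOCK-LETTER FAMILIES AND THE COUPLING PIN**: px10 g13's K3-door ✓`kernel137_family_of_kinvRow` at
`Δx := DeltaPiSlotP … (a L i)` fed `kinvRow_pi_family_of_blockLetters`; pin `|a L i| ≤ A L·((c₀ L∕cB L)·ℓ³)`; `c137 L := 1920·e^{μ L∕8+1}·(CK_π L + A L)` at rate `μ L∕8`, K-free.
[cite: Balaban1985BackgroundPropagators, (3.124)–(3.126) p.420, (3.132) p.422; Balaban1985Variational, (133), (137) p.298] -/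
theorem kernel137_pi_family_of_blockLetters
    (α : ℕ → ℝ) (hα : ∀ L : ℕ, 1 < L → 0 < α L) (hW : ∀ L : ℕ, 1 < L → 10 ^ 10 * (L : ℝ) ^ 6 * α L ≤ 1) (hW' : ∀ L : ℕ, 1 < L → 10 ^ 12 * (L : ℝ) ^ 3 * α L ≤ 1)
    (c₀ cB : ℕ → ℝ) [hc₀ : ∀ L : ℕ, Fact (0 < c₀ L)] [hcB : ∀ L : ℕ, Fact (0 < cB L)] (a : ∀ L : ℕ, Idx L → ℝ) (ha : ∀ (L : ℕ) (i : Idx L), 0 ≤ a L i)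
    (A : ℕ → ℝ) (hA : ∀ L, 1 < L → 0 ≤ A L) (haU : ∀ (L : ℕ), 1 < L → ∀ i : Idx L, |a L i| ≤ A L * ((c₀ L / cB L) * ((L : ℝ) ^ (i.1.2.2 - i.1.2.1)) ^ 3))
    (Λ : ∀ (L : ℕ) (i : Idx L), GaugeField (i.1.1.P i.1.2.2) 0 (Matrix.specialUnitaryGroup (Fin 2) ℂ) → Prop)
    (hposη : ∀ (L : ℕ), 1 < L → ∀ (i : Idx L) (U₀ : GaugeField (i.1.1.P i.1.2.2) 0 (Matrix.specialUnitaryGroup (Fin 2) ℂ)), ∀ ρ : ℝ, RegPr i.1.1 i.1.2.1 i.1.2.2 ρ U₀ → ρ ≤ α L →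
      Λ L i U₀ → PosOnto i.1.1 i.1.2.1 i.1.2.2 i.2.2.le (c₀ L) (cB L) (a L i) (DeltaEtaSlot i.1.1 i.1.2.1 i.1.2.2 (c₀ L)) U₀)
    (hpos : ∀ (L : ℕ), 1 < L → ∀ (i : Idx L) (U₀ : GaugeField (i.1.1.P i.1.2.2) 0 (Matrix.specialUnitaryGroup (Fin 2) ℂ)), ∀ ρ : ℝ, RegPr i.1.1 i.1.2.1 i.1.2.2 ρ U₀ → ρ ≤ α L →
      Λ L i U₀ → PosOnto i.1.1 i.1.2.1 i.1.2.2 i.2.2.le (c₀ L) (cB L) (a L i) (DeltaPiSlotP i.1.1 i.1.2.1 i.1.2.2 i.2.2.le (c₀ L) (cB L) (a L i)) U₀)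
    (BV BD C₁ C₂ C₃ δ δ₁ ν : ℕ → ℝ) (hBV : ∀ L, 1 < L → 0 ≤ BV L) (hBD : ∀ L, 1 < L → 0 ≤ BD L) (hC₁ : ∀ L, 1 < L → 0 ≤ C₁ L) (hC₂ : ∀ L, 1 < L → 0 ≤ C₂ L)
    (hC₃ : ∀ L, 1 < L → 0 ≤ C₃ L) (hδ : ∀ L, 1 < L → 0 ≤ δ L) (hν : ∀ L, 1 < L → 0 < ν L) (hδ₁ : ∀ L, 1 < L → δ L + ν L ≤ δ₁ L)
    (CK μ κ : ℕ → ℝ) (hCK : ∀ L, 1 < L → 0 ≤ CK L) (hμ : ∀ L, 1 < L → 0 < μ L) (hμδ : ∀ L, 1 < L → 2 * μ L ≤ δ L)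
    (hκ : ∀ L, 1 < L → (α L * (2 * ((BV L * (2 * (1 + 1 / ν L)) ^ 3) + (BD L * (2 * (1 + 1 / ν L)) ^ 3)) * (1 + Real.exp (4 * δ L)) * (2 * (C₁ L * (2 * (1 + 1 / ν L)) ^ 3) * (BV L * (2 * (1 + 1 / ν L)) ^ 3) + 6 * (C₃ L * (2 * (1 + 1 / ν L)) ^ 3) * (1 + (C₂ L * (2 * (1 + 1 / ν L)) ^ 3)) * ((C₂ L * (2 * (1 + 1 / ν L)) ^ 3) + 2 * α L * (1 + Real.exp (4 * δ L)) * (C₁ L * (2 * (1 + 1 / ν L)) ^ 3) * (BV L * (2 * (1 + 1 / ν L)) ^ 3))))) ≤ κ L)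
    (hKinv : ∀ (L : ℕ), 1 < L → ∀ (i : Idx L) (U₀ : GaugeField (i.1.1.P i.1.2.2) 0 (Matrix.specialUnitaryGroup (Fin 2) ℂ)), ∀ ρ : ℝ, RegPr i.1.1 i.1.2.1 i.1.2.2 ρ U₀ → ρ ≤ α L →
      Λ L i U₀ → ∀ (y : PBond (i.1.1.P i.1.2.1) 0) (Z : Matrix (Fin 2) (Fin 2) ℂ) (y' : PBond (i.1.1.P i.1.2.1) 0),
        ‖(toL2B i.1.1 i.1.2.1 (cB L)).symm (KinvT i.1.1 i.1.2.1 i.1.2.2 i.2.2.le (c₀ L) (cB L) (a L i) (DeltaEtaSlot i.1.1 i.1.2.1 i.1.2.2 (c₀ L)) U₀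
            (toL2B i.1.1 i.1.2.1 (cB L) (Pi.single y Z))) y'‖
          ≤ CK L * ((c₀ L / cB L) * ((L : ℝ) ^ (i.1.2.2 - i.1.2.1)) ^ 3)
              * Real.exp (-(μ L * (Site.tdist (siteShift (sites_eq i.1.1 i.1.2.1 i.1.2.2 i.2.2.le) y'.src) (siteShift (sites_eq i.1.1 i.1.2.1 i.1.2.2 i.2.2.le) y.src) : ℝ))) * ‖Z‖)
    (hGb : ∀ (L : ℕ), 1 < L → ∀ (i : Idx L) (U₀ : GaugeField (i.1.1.P i.1.2.2) 0 (Matrix.specialUnitaryGroup (Fin 2) ℂ)), ∀ ρ : ℝ, RegPr i.1.1 i.1.2.1 i.1.2.2 ρ U₀ → ρ ≤ α L →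
      Λ L i U₀ → ∀ (X : PBond (i.1.1.P i.1.2.2) 0 → Matrix (Fin 2) (Fin 2) ℂ) (z : Site (i.1.1.P i.1.2.2) (i.1.2.2 - i.1.2.1)),
        (∀ b, X b ≠ 0 → iterBlockOf (i.1.2.2 - i.1.2.1) b.src = z) → ∀ s : ℝ, 0 ≤ s → (∀ b, ‖X b‖ ≤ s) →
          ∀ bd : PBond (i.1.1.P i.1.2.2) 0, ‖(toL2 i.1.1 i.1.2.2 (c₀ L)).symm (GT i.1.1 i.1.2.1 i.1.2.2 i.2.2.le (c₀ L) (cB L) (a L i)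
              (DeltaEtaSlot i.1.1 i.1.2.1 i.1.2.2 (c₀ L)) U₀ (toL2 i.1.1 i.1.2.2 (c₀ L) X)) bd‖
            ≤ s * BV L * Real.exp (-(δ₁ L * (Site.tdist (P := i.1.1.P i.1.2.2) (iterBlockOf (i.1.2.2 - i.1.2.1) bd.src) z : ℝ))))
    (hDb : ∀ (L : ℕ), 1 < L → ∀ (i : Idx L) (U₀ : GaugeField (i.1.1.P i.1.2.2) 0 (Matrix.specialUnitaryGroup (Fin 2) ℂ)), ∀ ρ : ℝ, RegPr i.1.1 i.1.2.1 i.1.2.2 ρ U₀ → ρ ≤ α L →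
      Λ L i U₀ → ∀ (X : PBond (i.1.1.P i.1.2.2) 0 → Matrix (Fin 2) (Fin 2) ℂ) (z : Site (i.1.1.P i.1.2.2) (i.1.2.2 - i.1.2.1)),
        (∀ b, X b ≠ 0 → iterBlockOf (i.1.2.2 - i.1.2.1) b.src = z) → ∀ s : ℝ, 0 ≤ s → (∀ b, ‖X b‖ ≤ s) →
          ∀ x : Site (i.1.1.P i.1.2.2) 0, ‖(toL2S i.1.1 i.1.2.2 (c₀ L)).symm (DstarL2 i.1.1 i.1.2.1 i.1.2.2 (c₀ L) U₀ (GT i.1.1 i.1.2.1 i.1.2.2 i.2.2.le (c₀ L) (cB L) (a L i)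
              (DeltaEtaSlot i.1.1 i.1.2.1 i.1.2.2 (c₀ L)) U₀ (toL2 i.1.1 i.1.2.2 (c₀ L) X))) x‖
            ≤ s * BD L * Real.exp (-(δ₁ L * (Site.tdist (P := i.1.1.P i.1.2.2) (iterBlockOf (i.1.2.2 - i.1.2.1) x) z : ℝ))))
    (hc1b : ∀ (L : ℕ), 1 < L → ∀ (i : Idx L) (U₀ : GaugeField (i.1.1.P i.1.2.2) 0 (Matrix.specialUnitaryGroup (Fin 2) ℂ)), ∀ ρ : ℝ, RegPr i.1.1 i.1.2.1 i.1.2.2 ρ U₀ → ρ ≤ α L →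
      Λ L i U₀ → ∀ (v : Site (i.1.1.P i.1.2.2) 0 → Matrix (Fin 2) (Fin 2) ℂ) (z : Site (i.1.1.P i.1.2.2) (i.1.2.2 - i.1.2.1)),
        (∀ y, v y ≠ 0 → iterBlockOf (i.1.2.2 - i.1.2.1) y = z) → ∀ m : ℝ, 0 ≤ m → (∀ y, ‖v y‖ ≤ m) →
          ∀ y : Site (i.1.1.P i.1.2.2) 0, ‖(toL2S i.1.1 i.1.2.2 (c₀ L)).symm (GprimeP i.1.1 i.1.2.1 i.1.2.2 i.2.2.le (c₀ L) (cB L) (a L i) U₀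
              (RS i.1.1 i.1.2.1 i.1.2.2 i.2.2.le (c₀ L) (cB L) U₀ (toL2S i.1.1 i.1.2.2 (c₀ L) v))) y‖
            ≤ m * C₁ L * Real.exp (-(δ₁ L * (Site.tdist (P := i.1.1.P i.1.2.2) (iterBlockOf (i.1.2.2 - i.1.2.1) y) z : ℝ))))
    (hc2b : ∀ (L : ℕ), 1 < L → ∀ (i : Idx L) (U₀ : GaugeField (i.1.1.P i.1.2.2) 0 (Matrix.specialUnitaryGroup (Fin 2) ℂ)), ∀ ρ : ℝ, RegPr i.1.1 i.1.2.1 i.1.2.2 ρ U₀ → ρ ≤ α L →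
      Λ L i U₀ → ∀ (v : Site (i.1.1.P i.1.2.2) 0 → Matrix (Fin 2) (Fin 2) ℂ) (z : Site (i.1.1.P i.1.2.2) (i.1.2.2 - i.1.2.1)),
        (∀ y, v y ≠ 0 → iterBlockOf (i.1.2.2 - i.1.2.1) y = z) → ∀ m : ℝ, 0 ≤ m → (∀ y, ‖v y‖ ≤ m) →
          ∀ b : PBond (i.1.1.P i.1.2.2) 0, ‖(toL2 i.1.1 i.1.2.2 (c₀ L)).symm (DL2 i.1.1 i.1.2.1 i.1.2.2 (c₀ L) U₀ (GprimeP i.1.1 i.1.2.1 i.1.2.2 i.2.2.le (c₀ L) (cB L) (a L i) U₀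
              (RS i.1.1 i.1.2.1 i.1.2.2 i.2.2.le (c₀ L) (cB L) U₀ (toL2S i.1.1 i.1.2.2 (c₀ L) v)))) b‖
            ≤ m * C₂ L * Real.exp (-(δ₁ L * (Site.tdist (P := i.1.1.P i.1.2.2) (iterBlockOf (i.1.2.2 - i.1.2.1) b.src) z : ℝ))))
    (hc3b : ∀ (L : ℕ), 1 < L → ∀ (i : Idx L) (U₀ : GaugeField (i.1.1.P i.1.2.2) 0 (Matrix.specialUnitaryGroup (Fin 2) ℂ)), ∀ ρ : ℝ, RegPr i.1.1 i.1.2.1 i.1.2.2 ρ U₀ → ρ ≤ α L →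
      Λ L i U₀ → ∀ (v : Site (i.1.1.P i.1.2.2) 0 → Matrix (Fin 2) (Fin 2) ℂ) (z : Site (i.1.1.P i.1.2.2) (i.1.2.2 - i.1.2.1)),
        (∀ y, v y ≠ 0 → iterBlockOf (i.1.2.2 - i.1.2.1) y = z) → ∀ m : ℝ, 0 ≤ m → (∀ y, ‖v y‖ ≤ m) →
          ∀ y : Site (i.1.1.P i.1.2.2) 0, ‖(toL2S i.1.1 i.1.2.2 (c₀ L)).symm (RS i.1.1 i.1.2.1 i.1.2.2 i.2.2.le (c₀ L) (cB L) U₀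
              (GprimeP i.1.1 i.1.2.1 i.1.2.2 i.2.2.le (c₀ L) (cB L) (a L i) U₀ (toL2S i.1.1 i.1.2.2 (c₀ L) v))) y‖
            ≤ m * C₃ L * Real.exp (-(δ₁ L * (Site.tdist (P := i.1.1.P i.1.2.2) (iterBlockOf (i.1.2.2 - i.1.2.1) y) z : ℝ))))
    (hwin : ∀ L, 1 < L → 2 * (1 + Real.exp (4 * δ L)) * (α L * (C₁ L * (2 * (1 + 1 / ν L)) ^ 3) * (BV L * (2 * (1 + 1 / ν L)) ^ 3 + BD L * (2 * (1 + 1 / ν L)) ^ 3)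
      + 3 * α L * (C₃ L * (2 * (1 + 1 / ν L)) ^ 3) * (1 + C₂ L * (2 * (1 + 1 / ν L)) ^ 3)
        * (1 + C₂ L * (2 * (1 + 1 / ν L)) ^ 3 + 2 * (1 + Real.exp (4 * δ L)) * α L * (C₁ L * (2 * (1 + 1 / ν L)) ^ 3)
          * (BV L * (2 * (1 + 1 / ν L)) ^ 3 + BD L * (2 * (1 + 1 / ν L)) ^ 3))) ≤ 1 / 2)
    (hcone : ∀ L, 1 < L → CK L * (9600 * Real.exp (2 * μ L + 1) * κ L * (2 * (1 + 1 / μ L)) ^ 3) * (3 * (2 * (1 + 2 / μ L)) ^ 3) * (3 * (2 * (1 + 4 / μ L)) ^ 3) < 1) :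
    ∀ (L : ℕ), 1 < L → ∀ (i : Idx L) (U₀ : GaugeField (i.1.1.P i.1.2.2) 0 (Matrix.specialUnitaryGroup (Fin 2) ℂ)), ∀ ρ : ℝ, RegPr i.1.1 i.1.2.1 i.1.2.2 ρ U₀ → ρ ≤ α L →
      Λ L i U₀ → ∀ (y : PBond (i.1.1.P i.1.2.1) 0) (Z : Matrix (Fin 2) (Fin 2) ℂ) (b : PBond (i.1.1.P i.1.2.2) 0),
        ‖(toL2 i.1.1 i.1.2.2 (c₀ L)).symm (LinearMap.adjoint (Qk i.1.1 i.1.2.1 i.1.2.2 i.2.2.le (c₀ L) (cB L) U₀) (KinvT i.1.1 i.1.2.1 i.1.2.2 i.2.2.le (c₀ L) (cB L) (a L i)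
              (DeltaPiSlotP i.1.1 i.1.2.1 i.1.2.2 i.2.2.le (c₀ L) (cB L) (a L i)) U₀ (toL2B i.1.1 i.1.2.1 (cB L) (Pi.single y Z)))
            - LinearMap.adjoint (Qk i.1.1 i.1.2.1 i.1.2.2 i.2.2.le (c₀ L) (cB L) U₀) (((a L i : ℂ)) • toL2B i.1.1 i.1.2.1 (cB L) (Pi.single y Z))) b‖
          ≤ (1920 * Real.exp (μ L / 8 + 1) * (((1 / (1 - CK L * (9600 * Real.exp (2 * μ L + 1) * κ L * (2 * (1 + 1 / μ L)) ^ 3) * (3 * (2 * (1 + 2 / μ L)) ^ 3) * (3 * (2 * (1 + 4 / μ L)) ^ 3))) * CK L * (3 * (2 * (1 + 8 / μ L)) ^ 3)) + A L))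
              * Real.exp (-(μ L / 8 * (Site.tdist (iterBlockOf (i.1.2.2 - i.1.2.1) b.src) (siteShift (sites_eq i.1.1 i.1.2.1 i.1.2.2 i.2.2.le) y.src) : ℝ))) * ‖Z‖ := by
  have hKπ := kinvRow_pi_family_of_blockLetters α hα hW hW' c₀ cB a ha Λ hposη hpos BV BD C₁ C₂ C₃ δ δ₁ ν hBV hBD hC₁ hC₂ hC₃ hδ hν hδ₁ CK μ κ hCK hμ hμδ hκ hKinv
    hGb hDb hc1b hc2b hc3b hwin hcone
  have hκ0 : ∀ L, 1 < L → 0 ≤ κ L := fun L hL => by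
    have := hα L hL; have := hBV L hL; have := hBD L hL; have := hC₁ L hL; have := hC₂ L hL; have := hC₃ L hL; have := hν L hL
    exact le_trans (by positivity) (hκ L hL)
  have hCKπ : ∀ L, 1 < L → 0 ≤ ((1 / (1 - CK L * (9600 * Real.exp (2 * μ L + 1) * κ L * (2 * (1 + 1 / μ L)) ^ 3) * (3 * (2 * (1 + 2 / μ L)) ^ 3) * (3 * (2 * (1 + 4 / μ L)) ^ 3))) * CK L * (3 * (2 * (1 + 8 / μ L)) ^ 3)) := fun L hL => by
    have := hCK L hL; have := hμ L hL; have := hκ0 L hL; have h1 := hcone L hL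
    exact mul_nonneg (mul_nonneg (div_nonneg one_pos.le (by linarith)) (hCK L hL)) (by positivity)
  exact kernel137_family_of_kinvRow α hα hW hW' c₀ cB a A hA haU
    (fun L i => DeltaPiSlotP i.1.1 i.1.2.1 i.1.2.2 i.2.2.le (c₀ L) (cB L) (a L i)) Λ
    (fun L => ((1 / (1 - CK L * (9600 * Real.exp (2 * μ L + 1) * κ L * (2 * (1 + 1 / μ L)) ^ 3) * (3 * (2 * (1 + 2 / μ L)) ^ 3) * (3 * (2 * (1 + 4 / μ L)) ^ 3))) * CK L * (3 * (2 * (1 + 8 / μ L)) ^ 3))) (fun L => μ L / 8) hCKπ (fun L hL => by have := hμ L hL; positivity) hKπ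

end Summit.QuantumFields.YangMills.Theorems.Prop7PiSlotRowsOfCone

end
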